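import Mathlib.Analysis.Complex.TaylorSeries
import Mathlib.Analysis.Complex.Liouville
import Mathlib.Analysis.Complex.RemovableSingularity
import Mathlib.Analysis.Complex.Polynomial.Basic
import Mathlib.LinearAlgebra.Lagrange
import Mathlib.Algebra.MvPolynomial.Equiv
import Mathlib.Algebra.MvPolynomial.Funext
import Mathlib.Topology.Algebra.MvPolynomial
import Literature.NumberTheory.Transcendental.ZeroLocusConnected
import HarnessLib

/-!
# Entire functions of polynomial growth; functions polynomial on complex lines

Elementary lemmas of complex analysis used in the proof that an irreducible affine variety over
`ℂ` is connected in the classical topology (Shafarevich, *Basic Algebraic Geometry 2*, VII §2,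
second proof of Theorem 7.1; see `Literature/NumberTheory/Transcendental/ZeroLocusConnected.lean`).

* `Literature.NumberTheory.Transcendental.Complex.exists_polynomial_of_norm_le_pow` — **Shafarevich's Lemma 7.6** in one variable: an
  entire function `f` with `‖f z‖ ≤ C (1 + ‖z‖) ^ N` is a polynomial of degree `≤ N` (Cauchy's
  estimates kill the Taylor coefficients of order `> N`; Mathlib
  `Complex.norm_iteratedDeriv_le_of_forall_mem_sphere_norm_le`, `Complex.hasSum_taylorSeries_of_entire`).
* `Literature.NumberTheory.Transcendental.Complex.exists_polynomial_of_finite_of_norm_le_pow` — the same for `f` holomorphic off a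
  finite set with the growth bound there (Riemann's removable singularity theorem, Mathlib
  `Complex.differentiableOn_update_limUnder_of_bddAbove`, one point at a time). This is the
  one-variable substitute, along complex lines, for Shafarevich's Lemma 7.5 (Riemann extension
  across an algebraic hypersurface in `ℂⁿ`), which Mathlib lacks.
* `Literature.NumberTheory.Transcendental.exists_mvPolynomial_of_forall_line` — a continuous function on the complement
  `ℂⁿ ∖ Z(g)` of an algebraic hypersurface which, on every complex line not contained in `Z(g)`,
  agrees with a one-variable polynomial of degree `≤ N`, agrees with a polynomial in `n` variables
  (Lagrange interpolation in the first variable at `N + 1` nodes and induction on `n`; the two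
  sides are continuous and agree on a dense open subset). Together with the previous lemma this
  replaces Lemmas 7.5–7.6 in Shafarevich's argument.

## References

* I. R. Shafarevich, *Basic Algebraic Geometry 2*, Springer 1994, Book 3, Ch. VII §2.4,
  Lemmas 7.5, 7.6.
* W. Rudin, *Real and Complex Analysis*, Thm. 10.20 (removable singularities), 10.23 (Cauchy
  estimates / Liouville).
-/

noncomputable section

open Complex Polynomial Filter Topology Set

namespace Literature.NumberTheory.Transcendental

namespace Complex

/-! ### Lemma 7.6: entire functions of polynomial growth are polynomials -/

/-- Cauchy's estimate in the form: if `f` is entire and `‖f z‖ ≤ C (1 + ‖z‖) ^ N` then all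
Taylor coefficients at `0` of order `k > N` vanish. [Rudin RCA 10.23; Shafarevich1994 VII §2.4
Lemma 7.6] [folklore] -/
theorem iteratedDeriv_eq_zero_of_norm_le_pow {f : ℂ → ℂ} (hf : Differentiable ℂ f) {C : ℝ}
    {N : ℕ} (hb : ∀ z, ‖f z‖ ≤ C * (1 + ‖z‖) ^ N) {k : ℕ} (hk : N < k) :
    iteratedDeriv k f 0 = 0 := by
  have hC : 0 ≤ C := by
    have := hb 0
    simp only [norm_zero, add_zero, one_pow, mul_one] at this
    exact (norm_nonneg _).trans this
  set a := ‖iteratedDeriv k f 0‖ with ha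
  -- for every `R ≥ 1`, `a * R ≤ K₀ := k! * C * 2 ^ N`
  have key : ∀ R : ℝ, 1 ≤ R → a * R ≤ k.factorial * C * 2 ^ N := by
    intro R hR
    have hR0 : 0 < R := one_pos.trans_le hR
    have hest := Complex.norm_iteratedDeriv_le_of_forall_mem_sphere_norm_le (c := 0) (R := R)
      (C := C * (1 + R) ^ N) (f := f) k hR0 hf.diffContOnCl (fun z hz ↦ by
        rw [mem_sphere_zero_iff_norm] at hz
        simpa [hz] using hb z)
    -- `k! * (C (1+R)^N) / R^k ≤ k! * C * 2^N / R`
    have h1 : (1 + R) ^ N ≤ 2 ^ N * R ^ N := by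
      rw [← mul_pow]
      exact pow_le_pow_left₀ (by positivity) (by linarith) N
    have h2 : (k.factorial : ℝ) * (C * (1 + R) ^ N) / R ^ k ≤ k.factorial * C * 2 ^ N / R := by
      rw [div_le_div_iff₀ (pow_pos hR0 k) hR0]
      obtain ⟨j, rfl⟩ := Nat.exists_eq_add_of_lt hk
      have hRj : R ^ (N + j + 1) = R ^ N * R ^ j * R := by ring
      calc ((N + j + 1).factorial : ℝ) * (C * (1 + R) ^ N) * R
          ≤ (N + j + 1).factorial * (C * (2 ^ N * R ^ N)) * R := by
            gcongr
        _ = (N + j + 1).factorial * C * 2 ^ N * (R ^ N * 1 * R) := by ring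
        _ ≤ (N + j + 1).factorial * C * 2 ^ N * (R ^ N * R ^ j * R) := by
            gcongr
            exact one_le_pow₀ hR
        _ = (N + j + 1).factorial * C * 2 ^ N * R ^ (N + j + 1) := by rw [hRj]
    have h3 : a ≤ k.factorial * C * 2 ^ N / R := hest.trans h2
    rwa [le_div_iff₀ hR0] at h3
  -- hence `a = 0`
  have ha0 : a = 0 := by
    by_contra hne
    have hpos : 0 < a := lt_of_le_of_ne (norm_nonneg _) (Ne.symm hne)
    set K₀ := (k.factorial : ℝ) * C * 2 ^ N
    have hK₀ : 0 ≤ K₀ := by positivity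
    have := key (max 1 ((K₀ + 1) / a)) (le_max_left _ _)
    have h' : a * ((K₀ + 1) / a) ≤ a * max 1 ((K₀ + 1) / a) :=
      mul_le_mul_of_nonneg_left (le_max_right _ _) hpos.le
    rw [mul_div_cancel₀ _ hpos.ne'] at h'
    linarith
  exact norm_eq_zero.mp ha0

/-- **Shafarevich's Lemma 7.6 (one variable).** An entire function `f : ℂ → ℂ` of polynomial
growth, `‖f z‖ ≤ C (1 + ‖z‖) ^ N`, is a polynomial of degree at most `N`: by Cauchy's estimates
its Taylor coefficients of order `> N` vanish, and an entire function is the sum of its Taylor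
series. [cite: Shafarevich1994, Book 3 Ch. VII §2.4 Lemma 7.6] -/
theorem exists_polynomial_of_norm_le_pow {f : ℂ → ℂ} (hf : Differentiable ℂ f) {C : ℝ} {N : ℕ}
    (hb : ∀ z, ‖f z‖ ≤ C * (1 + ‖z‖) ^ N) :
    ∃ p : ℂ[X], p.natDegree ≤ N ∧ ∀ z, f z = p.eval z := by
  refine ⟨∑ k ∈ Finset.range (N + 1), Polynomial.C ((k.factorial : ℂ)⁻¹ * iteratedDeriv k f 0) *
    Polynomial.X ^ k, ?_, fun z ↦ ?_⟩
  · refine Polynomial.natDegree_sum_le_of_forall_le _ _ fun k hk ↦ ?_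
    refine (Polynomial.natDegree_C_mul_X_pow_le _ _).trans ?_
    exact Nat.lt_succ_iff.mp (Finset.mem_range.mp hk)
  · have hsum := Complex.hasSum_taylorSeries_of_entire hf 0 z
    simp only [sub_zero] at hsum
    have hfin : ∀ k ∉ Finset.range (N + 1),
        (k.factorial : ℂ)⁻¹ • z ^ k • iteratedDeriv k f 0 = 0 := by
      intro k hk
      rw [Finset.mem_range, not_lt] at hk
      rw [iteratedDeriv_eq_zero_of_norm_le_pow hf hb (Nat.lt_of_succ_le hk), smul_zero, smul_zero]
    have := (hasSum_sum_of_ne_finset_zero hfin).unique hsum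
    rw [← this, Polynomial.eval_finsetSum]
    refine Finset.sum_congr rfl fun k _ ↦ ?_
    simp only [Polynomial.eval_mul, Polynomial.eval_C, Polynomial.eval_pow, Polynomial.eval_X,
      smul_eq_mul]
    ring

/-! ### Removable singularities at finitely many points -/

/-- If two continuous real functions satisfy `u ≤ w` off a finite subset of `ℂ`, then `u ≤ w`
everywhere (a finite set has dense complement). [folklore] -/
theorem le_of_forall_not_mem_finite {T : Set ℂ} (hT : T.Finite) {u w : ℂ → ℝ} (hu : Continuous u)
    (hw : Continuous w) (h : ∀ z ∉ T, u z ≤ w z) (z : ℂ) : u z ≤ w z := by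
  have hd : Dense Tᶜ := by
    rw [Set.compl_eq_univ_sdiff]
    exact dense_univ.sdiff_finite hT
  have hcl : IsClosed {z | u z ≤ w z} := isClosed_le hu hw
  have : Tᶜ ⊆ {z | u z ≤ w z} := fun z hz ↦ h z hz
  have huniv := hd.mono this
  have hz : z ∈ closure {z | u z ≤ w z} := by
    rw [huniv.closure_eq]
    exact Set.mem_univ z
  rw [hcl.closure_eq] at hz
  exact hz

/-- **Riemann's removable singularity theorem at finitely many points, with Lemma 7.6**
(finset form). If `f` is holomorphic off a finite set `S ⊆ ℂ` and satisfies
`‖f z‖ ≤ C (1 + ‖z‖) ^ N` off a finite set `T ⊇ S`, then `f` agrees off `T` with a polynomial of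
degree `≤ N`: each point of `S` is a removable singularity (`f` is bounded near it), the extension
is entire of polynomial growth (the bound propagates by continuity), hence a polynomial.
[Rudin RCA 10.20; Shafarevich1994 VII §2.4 Lemmas 7.5–7.6]
[cite: Shafarevich1994, Book 3 Ch. VII §2.4 Lemma 7.6] -/
theorem exists_polynomial_of_finset_of_norm_le_pow (S : Finset ℂ) {T : Set ℂ} (hT : T.Finite)
    (hST : (S : Set ℂ) ⊆ T) {f : ℂ → ℂ} (hf : DifferentiableOn ℂ f (S : Set ℂ)ᶜ) {C : ℝ} {N : ℕ}
    (hb : ∀ z ∉ T, ‖f z‖ ≤ C * (1 + ‖z‖) ^ N) :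
    ∃ p : ℂ[X], p.natDegree ≤ N ∧ ∀ z ∉ T, f z = p.eval z := by
  induction S using Finset.induction_on generalizing f with
  | empty =>
    rw [Finset.coe_empty, Set.compl_empty, differentiableOn_univ] at hf
    -- the bound holds everywhere by continuity
    have hb' : ∀ z, ‖f z‖ ≤ C * (1 + ‖z‖) ^ N :=
      le_of_forall_not_mem_finite hT hf.continuous.norm (by fun_prop) hb
    obtain ⟨p, hp, hfp⟩ := exists_polynomial_of_norm_le_pow hf hb'
    exact ⟨p, hp, fun z _ ↦ hfp z⟩
  | insert c S₀ hcS₀ ih =>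
    rw [Finset.coe_insert] at hST hf
    have hcT : c ∈ T := hST (Set.mem_insert c _)
    have hS₀T : (S₀ : Set ℂ) ⊆ T := (Set.subset_insert c _).trans hST
    -- `C ≥ 0`: the bound holds at some point
    have hC : 0 ≤ C := by
      obtain ⟨z₀, hz₀⟩ := hT.infinite_compl.nonempty
      have h0 := hb z₀ hz₀
      have h1 : 0 < (1 + ‖z₀‖) ^ N := by positivity
      nlinarith [norm_nonneg (f z₀)]
    -- a ball around `c` missing `T ∖ {c}` (hence `S₀`)
    have hTc : IsClosed (T \ {c}) := (hT.subset Set.sdiff_subset).isClosed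
    obtain ⟨ε, hε, hball⟩ : ∃ ε > 0, Metric.ball c ε ⊆ (T \ {c})ᶜ :=
      Metric.isOpen_iff.mp hTc.isOpen_compl c (fun h ↦ h.2 rfl)
    -- remove the singularity at `c`
    set f₁ : ℂ → ℂ := Function.update f c (limUnder (𝓝[≠] c) f) with hf₁
    have hdiff_ball : DifferentiableOn ℂ f₁ (Metric.ball c ε) := by
      refine Complex.differentiableOn_update_limUnder_of_bddAbove (Metric.ball_mem_nhds c hε)
        (hf.mono ?_) ⟨C * (1 + (‖c‖ + ε)) ^ N, ?_⟩
      · rintro z ⟨hz, hzc⟩ hmem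
        rcases hmem with rfl | hzS₀
        · exact hzc (Set.mem_singleton _)
        · exact hball hz ⟨hS₀T hzS₀, hzc⟩
      · rintro _ ⟨z, ⟨hz, hzc⟩, rfl⟩
        have hzT : z ∉ T := fun hzT ↦ hball hz ⟨hzT, hzc⟩
        refine (hb z hzT).trans ?_
        gcongr
        rw [Metric.mem_ball, dist_eq_norm] at hz
        calc ‖z‖ = ‖c + (z - c)‖ := by rw [add_sub_cancel]
          _ ≤ ‖c‖ + ‖z - c‖ := norm_add_le _ _
          _ ≤ ‖c‖ + ε := by linarith
    have hf₁f : ∀ z, z ≠ c → f₁ z = f z := fun z hz ↦ Function.update_of_ne hz _ _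
    have hdiff : DifferentiableOn ℂ f₁ (S₀ : Set ℂ)ᶜ := by
      intro z hz
      by_cases hzb : z ∈ Metric.ball c ε
      · exact (hdiff_ball.differentiableAt (Metric.isOpen_ball.mem_nhds hzb)).differentiableWithinAt
      · have hzc : z ≠ c := by
          rintro rfl
          exact hzb (Metric.mem_ball_self hε)
        have hzS : z ∈ (insert c (S₀ : Set ℂ))ᶜ := by
          intro hmem
          rcases hmem with rfl | h
          · exact hzc rfl
          · exact hz h
        have hopen : IsOpen (insert c (S₀ : Set ℂ))ᶜ :=
          (S₀.finite_toSet.insert c).isClosed.isOpen_compl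
        have hfz : DifferentiableAt ℂ f z := hf.differentiableAt (hopen.mem_nhds hzS)
        refine (hfz.congr_of_eventuallyEq ?_).differentiableWithinAt
        filter_upwards [isOpen_compl_singleton.mem_nhds hzc] with w hw
        exact hf₁f w hw
    have hb₁ : ∀ z ∉ T, ‖f₁ z‖ ≤ C * (1 + ‖z‖) ^ N := by
      intro z hz
      rw [hf₁f z (fun h ↦ hz (h ▸ hcT))]
      exact hb z hz
    obtain ⟨p, hp, hfp⟩ := ih hS₀T hdiff hb₁
    refine ⟨p, hp, fun z hz ↦ ?_⟩
    rw [← hf₁f z (fun h ↦ hz (h ▸ hcT))]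
    exact hfp z hz

/-- **Riemann's removable singularity theorem at finitely many points, with Lemma 7.6.** If `f`
is holomorphic off a finite set `S ⊆ ℂ` and `‖f z‖ ≤ C (1 + ‖z‖) ^ N` there, then `f` agrees
off `S` with a polynomial of degree `≤ N`. [Rudin RCA 10.20; Shafarevich1994 VII §2.4]
[cite: Shafarevich1994, Book 3 Ch. VII §2.4 Lemma 7.6] -/
theorem exists_polynomial_of_finite_of_norm_le_pow {S : Set ℂ} (hS : S.Finite) {f : ℂ → ℂ}
    (hf : DifferentiableOn ℂ f Sᶜ) {C : ℝ} {N : ℕ} (hb : ∀ z ∉ S, ‖f z‖ ≤ C * (1 + ‖z‖) ^ N) :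
    ∃ p : ℂ[X], p.natDegree ≤ N ∧ ∀ z ∉ S, f z = p.eval z := by
  have h := exists_polynomial_of_finset_of_norm_le_pow hS.toFinset (T := S) hS
    (by simp) (f := f) (by simpa using hf) hb
  exact h

end Complex

/-! ### Functions which are polynomial on every complex line -/

section Lines

open MvPolynomial

/-- Complex lines inside a coordinate slice: `(l, a) + s (0, v) = (l, a + s v)`. [folklore] -/
theorem cons_add_smul_cons_zero {n : ℕ} (l : ℂ) (a v : Fin n → ℂ) (s : ℂ) :
    (Fin.cons l a : Fin (n + 1) → ℂ) + s • Fin.cons 0 v = Fin.cons l (a + s • v) := by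
  ext i
  refine Fin.cases ?_ (fun j ↦ ?_) i <;> simp

/-- The vertical line through `(·, w)`: `(0, w) + s (1, 0) = (s, w)`. [folklore] -/
theorem cons_zero_add_smul_cons_one {n : ℕ} (w : Fin n → ℂ) (s : ℂ) :
    (Fin.cons 0 w : Fin (n + 1) → ℂ) + s • Fin.cons 1 (0 : Fin n → ℂ) = Fin.cons s w := by
  ext i
  refine Fin.cases ?_ (fun j ↦ ?_) i <;> simp

/-- The slice `g(s, ·)` of a polynomial `g` in `n + 1` variables at first coordinate `s`, as a
polynomial in the remaining `n` variables (via Mathlib `MvPolynomial.finSuccEquiv`). [folklore] -/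
def sliceZero {n : ℕ} (g : MvPolynomial (Fin (n + 1)) ℂ) (s : ℂ) : MvPolynomial (Fin n) ℂ :=
  Polynomial.eval (C s) (finSuccEquiv ℂ n g)

/-- `sliceZero g s` evaluated at `w` is `g(s, w)`. [folklore] -/
theorem eval_sliceZero {n : ℕ} (g : MvPolynomial (Fin (n + 1)) ℂ) (s : ℂ) (w : Fin n → ℂ) :
    eval w (sliceZero g s) = eval (Fin.cons s w) g := by
  rw [eval_eq_eval_mv_eval', Polynomial.eval_map, sliceZero, Polynomial.eval,
    Polynomial.hom_eval₂, RingHom.comp_id, MvPolynomial.eval_C]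

/-- Only finitely many slices of a nonzero polynomial vanish identically. [folklore] -/
theorem finite_setOf_sliceZero_eq_zero {n : ℕ} {g : MvPolynomial (Fin (n + 1)) ℂ} (hg : g ≠ 0) :
    {s : ℂ | sliceZero g s = 0}.Finite := by
  have hq : finSuccEquiv ℂ n g ≠ 0 := (map_ne_zero_iff _ (finSuccEquiv ℂ n).injective).mpr hg
  have : {s : ℂ | sliceZero g s = 0} =
      (C : ℂ → MvPolynomial (Fin n) ℂ) ⁻¹' {x | (finSuccEquiv ℂ n g).IsRoot x} := rfl
  rw [this]
  exact (Polynomial.finite_setOf_isRoot hq).preimage (C_injective _ _).injOn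

/-- Evaluating `b(X₀) ∈ ℂ[z₀, …, zₙ]` (a one-variable polynomial `b` in the first coordinate)
at `z` gives `b(z₀)`. [folklore] -/
theorem eval_polynomial_aeval_X_zero {n : ℕ} (b : ℂ[X]) (z : Fin (n + 1) → ℂ) :
    eval z (Polynomial.aeval (X 0 : MvPolynomial (Fin (n + 1)) ℂ) b) = b.eval (z 0) := by
  change aeval z (Polynomial.aeval (X 0 : MvPolynomial (Fin (n + 1)) ℂ) b) = _
  rw [← Polynomial.aeval_algHom_apply, MvPolynomial.aeval_X, Polynomial.coe_aeval_eq_eval]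

/-- **A continuous function which is a polynomial of bounded degree on every complex line is a
polynomial.** Let `g ≠ 0` be a polynomial on `ℂⁿ`, `V = {g ≠ 0}`, and `G : V → ℂ` continuous
such that for every complex line `s ↦ a + s v` not contained in `Z(g)` there is a one-variable
polynomial `e` of degree `≤ N` with `G(a + s v) = e(s)` whenever `g(a + s v) ≠ 0`. Then there is a
polynomial `P` in `n` variables with `G = P` on `V`. Proof: induction on `n`; Lagrange
interpolation in the first variable at `N + 1` nodes `l` with `g(l, ·) ≢ 0` expresses `G(z₀, w)`
through the `G(l, w)`, which are polynomials in `w` by induction, for `w` off a proper algebraic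
subset; both sides being continuous on `V`, they agree on `V`. (This elementary statement is the
substitute, in Shafarevich's second proof of Theorem 7.1, for Lemma 7.5 = Riemann's extension
theorem across an algebraic hypersurface of `ℂⁿ`, applied linewise.) [folklore] -/
theorem exists_mvPolynomial_of_forall_line (N n : ℕ) :
    ∀ {g : MvPolynomial (Fin n) ℂ}, g ≠ 0 → ∀ {G : (Fin n → ℂ) → ℂ},
      ContinuousOn G {z | eval z g ≠ 0} →
      (∀ a v : Fin n → ℂ, (∃ s : ℂ, eval (a + s • v) g ≠ 0) →
        ∃ e : ℂ[X], e.natDegree ≤ N ∧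
          ∀ s : ℂ, eval (a + s • v) g ≠ 0 → G (a + s • v) = e.eval s) →
      ∃ P : MvPolynomial (Fin n) ℂ, ∀ z, eval z g ≠ 0 → G z = eval z P := by
  induction n with
  | zero =>
    intro g hg G _ _
    refine ⟨C (G finZeroElim), fun z _ ↦ ?_⟩
    rw [MvPolynomial.eval_C, Subsingleton.elim z finZeroElim]
  | succ n ih =>
    intro g hg G hG hL
    -- nodes: `N + 1` values `l` with nonzero slice `g(l, ·)`
    obtain ⟨T, hTsub, hTcard⟩ :=
      (finite_setOf_sliceZero_eq_zero hg).infinite_compl.exists_subset_card_eq (N + 1)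
    have hnode : ∀ l ∈ T, sliceZero g l ≠ 0 := fun l hl h ↦ hTsub hl h
    -- induction hypothesis on each good slice
    have IH' : ∀ l ∈ T, ∃ Pl : MvPolynomial (Fin n) ℂ,
        ∀ w, eval w (sliceZero g l) ≠ 0 → G (Fin.cons l w) = eval w Pl := by
      intro l hl
      refine ih (hnode l hl) (G := fun w ↦ G (Fin.cons l w)) ?_ ?_
      · refine hG.comp (Continuous.continuousOn ?_) fun w hw ↦ ?_
        · exact continuous_const.finCons continuous_id
        · simpa only [Set.mem_setOf_eq, eval_sliceZero] using hw
      · rintro a v ⟨s₀, hs₀⟩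
        obtain ⟨e, he, hGe⟩ := hL (Fin.cons l a) (Fin.cons 0 v)
          ⟨s₀, by rwa [cons_add_smul_cons_zero, ← eval_sliceZero]⟩
        refine ⟨e, he, fun s hs ↦ ?_⟩
        have := hGe s (by rwa [cons_add_smul_cons_zero, ← eval_sliceZero])
        rwa [cons_add_smul_cons_zero] at this
    choose! Pl hPl using IH'
    -- the interpolating polynomial
    let P : MvPolynomial (Fin (n + 1)) ℂ :=
      ∑ l ∈ T, rename Fin.succ (Pl l) *
        Polynomial.aeval (X 0 : MvPolynomial (Fin (n + 1)) ℂ) (Lagrange.basis T id l)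
    have hPeval : ∀ z : Fin (n + 1) → ℂ,
        eval z P = ∑ l ∈ T, eval (Fin.tail z) (Pl l) * (Lagrange.basis T id l).eval (z 0) := by
      intro z
      simp only [P, map_sum, map_mul, eval_rename, eval_polynomial_aeval_X_zero]
      rfl
    -- Step A: agreement on slices `(z₀, w)` with `w` good for all nodes
    have hA : ∀ (z₀ : ℂ) (w : Fin n → ℂ), (∀ l ∈ T, eval w (sliceZero g l) ≠ 0) →
        eval (Fin.cons z₀ w) g ≠ 0 → G (Fin.cons z₀ w) = eval (Fin.cons z₀ w) P := by
      intro z₀ w hw hz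
      obtain ⟨e, he, hGe⟩ := hL (Fin.cons 0 w) (Fin.cons 1 0)
        ⟨z₀, by rwa [cons_zero_add_smul_cons_one]⟩
      have hGe' : ∀ s, eval (Fin.cons s w) g ≠ 0 → G (Fin.cons s w) = e.eval s := fun s hs ↦ by
        have := hGe s (by rwa [cons_zero_add_smul_cons_one])
        rwa [cons_zero_add_smul_cons_one] at this
      have hdeg : e.degree < T.card := by
        refine lt_of_le_of_lt Polynomial.degree_le_natDegree ?_
        rw [hTcard]
        exact_mod_cast Nat.lt_succ_of_le he
      have heint := Lagrange.eq_interpolate (v := id) (s := T) (Set.injOn_id _) hdeg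
      rw [hGe' z₀ hz, hPeval, Fin.tail_cons, Fin.cons_zero]
      conv_lhs => rw [heint]
      simp only [Lagrange.interpolate_apply, Polynomial.eval_finsetSum, Polynomial.eval_mul,
        Polynomial.eval_C, id]
      refine Finset.sum_congr rfl fun l hl ↦ ?_
      rw [← hPl l hl w (hw l hl), hGe' l ((eval_sliceZero g l w) ▸ hw l hl)]
    -- Step B: both sides are continuous on `V` and agree on a dense open subset
    have hprod : (∏ l ∈ T, sliceZero g l) ≠ 0 := Finset.prod_ne_zero_iff.mpr hnode
    have hh : rename Fin.succ (∏ l ∈ T, sliceZero g l) ≠ 0 :=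
      (map_ne_zero_iff _ (rename_injective _ (Fin.succ_injective n))).mpr hprod
    have hD : Dense {z : Fin (n + 1) → ℂ | eval z (rename Fin.succ (∏ l ∈ T, sliceZero g l)) ≠ 0} :=
      dense_setOf_eval_ne_zero hh
    have hgood : ∀ z : Fin (n + 1) → ℂ, eval z (rename Fin.succ (∏ l ∈ T, sliceZero g l)) ≠ 0 →
        ∀ l ∈ T, eval (Fin.tail z) (sliceZero g l) ≠ 0 := by
      intro z hz
      rw [eval_rename, map_prod] at hz
      exact fun l hl ↦ Finset.prod_ne_zero_iff.mp hz l hl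
    refine ⟨P, fun z hz ↦ ?_⟩
    by_contra hne
    have hVopen : IsOpen {z : Fin (n + 1) → ℂ | eval z g ≠ 0} :=
      isOpen_ne_fun (MvPolynomial.continuous_eval g) continuous_const
    have hO : IsOpen ({z : Fin (n + 1) → ℂ | eval z g ≠ 0} ∩
        (fun y ↦ G y - eval y P) ⁻¹' {0}ᶜ) :=
      (hG.sub (MvPolynomial.continuous_eval P).continuousOn).isOpen_inter_preimage hVopen
        isOpen_compl_singleton
    obtain ⟨y, ⟨hyV, hyO⟩, hyD⟩ := hD.inter_open_nonempty _ hO ⟨z, hz, sub_ne_zero.mpr hne⟩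
    refine hyO (sub_eq_zero.mpr ?_)
    have hy : y = Fin.cons (y 0) (Fin.tail y) := (Fin.cons_self_tail y).symm
    rw [hy]
    exact hA (y 0) (Fin.tail y) (hgood y hyD) (hy ▸ hyV)

end Lines

end Literature.NumberTheory.Transcendental
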